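import Literature.Analysis.FluidPDE.MikadoCascadeResidual
import Literature.Analysis.FluidPDE.AntidivergenceLinear
import HarnessLib

/-!
# The self-interaction of one Coiculescu–Palasek level and the block residual:
# `v^p_k ⊗ v^p_k = 𝒩_{k,1} + 𝒩_{k,2}`, `F_k = -(∂ₜ-Δ)R_k + ΔR̄_{k-1} + 𝒩_{k,1} + 𝒩_{k,2} - ℛ div 𝒩_{k,2}`,
# and the block momentum identity `∂ₜ(v_k + v̄_{k-1}) = Δ(v_k + v̄_{k-1}) - ∇π_k - div F_k`

Analysis/FluidPDE support file (definitions with proved API; no named facts) on the discharge path of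
the principal-parts hypothesis `hA` of
`Literature.Barriers.NavierStokesRegularity.CriticalDataSmoothNonuniqueness_of_principalParts_of_perturbationLe`
(M. P. Coiculescu, S. Palasek, Invent. Math. 244 (2025), arXiv:2503.14699, Prop. 4.1). The paper's residual
`F = F₁ + F₂ + F₃ + F₄` with `F₃ = 0`, `F₄ = -v⊗v + ∑_k (v_k^p⊗v_k^p - ℛ div 𝒩_{k,2})`, is organised by level:
for the data `I : CP25.IterData` (`h : I.Admissible`) and every level `k`,

* `CP25.IterData.vpField k j = rate_{k,j} a_{j,k}Ψ⁰_{j,k}` (the principal part `v^p_{j,k}` before the time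
  factor), `selfInteraction k t = ∑_j e^{-2rate t} v^p_{j,k} ⊗ v^p_{j,k}` (the paper's `v_k^p⊗v_k^p` with the cross
  terms `𝒩_{k,3}` already discarded — they vanish by the disjointness of the pipes, which only the ESTIMATE
  file needs), `N2 k t = selfInteraction k t - N1 k t` (`= 𝒩_{k,2}`);
* `CP25.antidivTensor u` — the De Lellis–Székelyhidi antidivergence `Torus.antidivergence` as a real
  `3×3` tensor, with `tensorDiv_antidivTensor` (`div ℛu = u` on mean-zero fields) and symmetry;
* `CP25.IterData.Fblock k t = heatResidual k t + RbarLap k t + selfInteraction k t - ℛ div (N2 k t)`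
  (the level-`k` part of `F₁ + F₂ + F₄ + v⊗v`), `presBlock k t = QbarDt k t - QbarLap k t` (the level-`k`
  pressure), `heatDt k t` (the heat part of `∂ₜ`);
* **`tensorDiv_Fblock`**: `div F_k = -(∂ₜv_k - Δv_k) + div ΔR̄_{k-1} - div ∂ₜR̄_{k-1}` and the **block momentum
  identity** `blockDt_eq_laplacian_sub`: `∂ₜ(v_k+v̄_{k-1}) = Δ(v_k+v̄_{k-1}) - ∇π_k - div F_k` pointwise;
* the generic identity `convect_eq_tensorDiv_prod`: `(v·∇)v = div (v⊗v)` for smooth divergence-free `v`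
  (for the nonlinear term of the full residual `F = ∑_k F_k - v⊗v`, assembled over the schedule in
  `MikadoResidualIdentity`).

## Mathlib / tree search

Tree: `Torus.antidivergence`, `tensorDivergence_antidivergence`, `antidivergence_symm`, linearity
(`Antidivergence`, `AntidivergenceLinear`), `Torus.partialDeriv_mul`, `fderiv_apply_eq_sum_partialDeriv`
(`TorusCalculusProofs`), the level-`k` residual files `MikadoHeatResidual`, `MikadoCascadeResidual`.

## On the hypothesis `h : I.Admissible`

`CP25.IterData.Admissible I` (a `structure … : Prop` of `MikadoDataIteration`) bundles the standing
HYPOTHESES on the abstract inputs `I`; it is PROVED for the paper's concrete inputs in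
`CP25.admissible_mkIter` (`MikadoInputs`). Nothing here assumes a conclusion.

## References

* M. P. Coiculescu, S. Palasek, Invent. Math. 244 (2025) 165–219, doi:10.1007/s00222-025-01396-z,
  arXiv:2503.14699: §4.1, Prop. 4.1 (`v_k^p`, `𝒩_{k,i}`, `F₁`–`F₄`, (Frequirement)). [CoiculescuPalasek2025]
* A. Cheskidov, X. Luo, Invent. Math. 229 (2022), §7.2 Def. 7.2 (the operator `ℛ`). [CheskidovLuo2022]
-/

noncomputable section

open MeasureTheory Set Filter Function
open _root_.Topology
open scoped BigOperators ContDiff ENNReal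

namespace Literature.Analysis.FluidPDE

namespace CP25

open Literature.Analysis.FunctionSpaces Literature.Analysis.FunctionSpaces.Torus

/-! ## Generic: the antidivergence as a real tensor; `(v·∇)v = div(v⊗v)` -/

section Generic

/-- The antidivergence `ℛu` as a real `3×3` tensor (rows `a`, columns `b`). [cite: CheskidovLuo2022, §7.2 Def. 7.2] -/
def antidivTensor (u : UnitAddTorus (Fin 3) → EuclideanSpace ℝ (Fin 3)) (x : UnitAddTorus (Fin 3)) (a b : Fin 3) : ℝ :=
  Torus.antidivEntry u a b x

variable {u : UnitAddTorus (Fin 3) → EuclideanSpace ℝ (Fin 3)}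

/-- `ℛu` is symmetric. [cite: CheskidovLuo2022, §7.2] -/
theorem antidivTensor_symm (hu : IsSmooth u) (x : UnitAddTorus (Fin 3)) (a b : Fin 3) :
    antidivTensor u x a b = antidivTensor u x b a := by
  have h := Torus.antidivergence_symm hu x b a
  rwa [Torus.antidivergence_apply, Torus.antidivergence_apply] at h

/-- `ℛu` is smooth. [folklore] -/
theorem isSmooth_antidivTensor (hu : IsSmooth u) : IsSmooth (antidivTensor u) :=
  contDiff_pi.2 fun a => contDiff_pi.2 fun b => Torus.isSmooth_antidivEntry hu a b

/-- **`div ℛu = u` for smooth mean-zero `u`** (row divergence of the real tensor). [cite: CheskidovLuo2022, §7.2 ("`div ℛv = v - ⨍v`")] -/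
theorem tensorDiv_antidivTensor (hu : IsSmooth u) (h0 : Torus.HasZeroMean u) (x : UnitAddTorus (Fin 3)) :
    tensorDiv (antidivTensor u) x = u x := by
  have hdiv := Torus.tensorDivergence_antidivergence (d := Fin 3) (by simp) hu x
  rw [h0, sub_zero] at hdiv
  rw [← hdiv]
  ext i
  rw [tensorDiv_apply, Torus.tensorDivergence, WithLp.ofLp_sum, Finset.sum_apply]
  refine Finset.sum_congr rfl fun j _ => ?_
  have hcol : IsContDiff 1 (fun y => Torus.antidivergence u y j) :=
    ((Torus.isSmooth_antidivergence hu).column j).isContDiff (by simp)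
  rw [← partialDeriv_apply_coord hcol j x i]
  rfl

/-- `ℛ` is linear: finite weighted sums. [folklore] -/
theorem antidivTensor_finset_sum_smul {ι : Type*} (s : Finset ι) (c : ι → ℝ)
    {ui : ι → UnitAddTorus (Fin 3) → EuclideanSpace ℝ (Fin 3)} (hu : ∀ i ∈ s, IsSmooth (ui i))
    (x : UnitAddTorus (Fin 3)) (a b : Fin 3) :
    antidivTensor (fun y => ∑ i ∈ s, c i • ui i y) x a b = ∑ i ∈ s, c i * antidivTensor (ui i) x a b := by
  unfold antidivTensor
  have hs : ∀ i ∈ s, IsSmooth (fun y => c i • ui i y) := fun i hi => (hu i hi).smul (c i)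
  have h1 := Torus.antidivergence_finset_sum_apply s hs x
  have h2 : ∀ i ∈ s, Torus.antidivergence (fun y => c i • ui i y) x = c i • Torus.antidivergence (ui i) x :=
    fun i hi => Torus.antidivergence_const_smul_apply (hu i hi) (c i) x
  have hval : Torus.antidivEntry (fun y => ∑ i ∈ s, c i • ui i y) a b x =
      (∑ i ∈ s, c i • Torus.antidivergence (ui i) x) b a := by
    rw [← Torus.antidivergence_apply, h1, Finset.sum_congr rfl h2]
  rw [hval]
  simp [Finset.sum_apply, Torus.antidivergence_apply]

/-- A tensor field is smooth if its entries are. [folklore] -/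
theorem isSmooth_of_entries {G : UnitAddTorus (Fin 3) → (Fin 3 → Fin 3 → ℝ)} (hG : ∀ a b, IsSmooth fun x => G x a b) :
    IsSmooth G :=
  contDiff_pi.2 fun a => contDiff_pi.2 fun b => hG a b

/-- `div (G + H) = div G + div H` for smooth tensors (pointwise-sum form). [folklore] -/
theorem tensorDiv_add' {G H : UnitAddTorus (Fin 3) → (Fin 3 → Fin 3 → ℝ)} (hG : IsSmooth G) (hH : IsSmooth H)
    (x : UnitAddTorus (Fin 3)) :
    tensorDiv (fun y a b => G y a b + H y a b) x = tensorDiv G x + tensorDiv H x := by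
  ext i
  simp only [tensorDiv_apply, WithLp.ofLp_add, Pi.add_apply, ← Finset.sum_add_distrib]
  refine Finset.sum_congr rfl fun j _ => ?_
  exact Torus.partialDeriv_add_apply ((isSmooth_entry hG i j).isContDiff (by simp)) ((isSmooth_entry hH i j).isContDiff (by simp)) j x

/-- `div (G - H) = div G - div H` for smooth tensors (pointwise-difference form). [folklore] -/
theorem tensorDiv_sub' {G H : UnitAddTorus (Fin 3) → (Fin 3 → Fin 3 → ℝ)} (hG : IsSmooth G) (hH : IsSmooth H)
    (x : UnitAddTorus (Fin 3)) :
    tensorDiv (fun y a b => G y a b - H y a b) x = tensorDiv G x - tensorDiv H x := by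
  ext i
  simp only [tensorDiv_apply, WithLp.ofLp_sub, Pi.sub_apply, ← Finset.sum_sub_distrib]
  refine Finset.sum_congr rfl fun j _ => ?_
  exact Torus.partialDeriv_sub_at ((isSmooth_entry hG i j).isContDiff (by simp)) ((isSmooth_entry hH i j).isContDiff (by simp)) j x

/-- `∇(p - q) = ∇p - ∇q` for smooth scalars (pointwise-difference form). [folklore] -/
theorem gradient_sub' {p q : UnitAddTorus (Fin 3) → ℝ} (hp : IsSmooth p) (hq : IsSmooth q) (x : UnitAddTorus (Fin 3)) :
    Torus.gradient (fun y => p y - q y) x = Torus.gradient p x - Torus.gradient q x := by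
  ext i
  rw [BDSV.gradient_apply' (θ := fun y => p y - q y) ((hp.sub hq).isContDiff (by simp)), WithLp.ofLp_sub, Pi.sub_apply,
    BDSV.gradient_apply' (hp.isContDiff (by simp)), BDSV.gradient_apply' (hq.isContDiff (by simp))]
  exact Torus.partialDeriv_sub_at (hp.isContDiff (by simp)) (hq.isContDiff (by simp)) i x

/-- **`(v·∇)v = div(v⊗v)`** for smooth divergence-free `v` (`∑_b ∂_b(v_a v_b) = ∑_b v_b ∂_b v_a + v_a div v`). [folklore] -/
theorem convect_eq_tensorDiv_prod {v : UnitAddTorus (Fin 3) → EuclideanSpace ℝ (Fin 3)} (hv : IsSmooth v)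
    (hdiv : Torus.IsDivFree v) (x : UnitAddTorus (Fin 3)) :
    Torus.convect v v x = tensorDiv (fun y a b => v y a * v y b) x := by
  have h1 : IsContDiff 1 v := hv.isContDiff (by simp)
  have hc : ∀ a, IsContDiff 1 (fun y => v y a) := fun a => (hv.apply a).isContDiff (by simp)
  ext a
  rw [Torus.convect, fderiv_apply_eq_sum_partialDeriv h1, WithLp.ofLp_sum, Finset.sum_apply, tensorDiv_apply]
  have hprod : ∀ b, Torus.partialDeriv b (fun y => v y a * v y b) x =
      v x a * Torus.partialDeriv b (fun y => v y b) x + Torus.partialDeriv b (fun y => v y a) x * v x b :=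
    fun b => partialDeriv_mul (hc a) (hc b) b x
  simp only [hprod, Finset.sum_add_distrib, ← Finset.mul_sum]
  have hd := hdiv x
  rw [Torus.divergence] at hd
  rw [hd, mul_zero, zero_add]
  refine Finset.sum_congr rfl fun b _ => ?_
  rw [WithLp.ofLp_smul, Pi.smul_apply, smul_eq_mul, mul_comm, partialDeriv_apply_coord h1 b x a]

end Generic

/-! ## The self-interaction and the block residual of level `k` -/

namespace IterData

variable (I : IterData)

/-- **`v^p_{j,k}` before the time factor**: `rate_{k,j} a_{j,k}Ψ⁰_{j,k}` (`v_k^p(t) = ∑_j e^{-rate t} vpField k j`;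
this is `N_k²|η_j|² a_{j,k}Ψ_{j,k}` up to the `4π²` of the tree's phases). [cite: CoiculescuPalasek2025, Prop. 4.1 (`v_k^p`)] -/
def vpField (k : ℕ) (j : Fin 6) (x : UnitAddTorus (Fin 3)) : EuclideanSpace ℝ (Fin 3) := I.rate k j • I.apsi k j x

/-- **The self-interaction `∑_j v^p_{j,k}(t) ⊗ v^p_{j,k}(t)`** (`= 𝒩_{k,1} + 𝒩_{k,2}`). [cite: CoiculescuPalasek2025, Prop. 4.1] -/
def selfInteraction (k : ℕ) (t : ℝ) (x : UnitAddTorus (Fin 3)) (a b : Fin 3) : ℝ :=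
  ∑ j, Real.exp (-(2 * I.rate k j * t)) * (I.vpField k j x a * I.vpField k j x b)

/-- **`𝒩_{k,2}(t) = ∑_j v^p⊗v^p - 𝒩_{k,1}(t)`** (the oscillatory part). [cite: CoiculescuPalasek2025, Prop. 4.1 (`𝒩_{k,2}`)] -/
def N2 (k : ℕ) (t : ℝ) (x : UnitAddTorus (Fin 3)) (a b : Fin 3) : ℝ :=
  I.selfInteraction k t x a b - I.N1 k t x a b

/-- The heat part of `∂ₜ(v_k + v̄_{k-1})`: `∑_j (-rate) e^{-rate t} V_{j,k}`. [cite: CoiculescuPalasek2025, §4.1] -/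
def heatDt (k : ℕ) (t : ℝ) (x : UnitAddTorus (Fin 3)) : EuclideanSpace ℝ (Fin 3) :=
  ∑ j, (-(I.rate k j) * Real.exp (-(I.rate k j * t))) • I.Vfield k j x

/-- **The level-`k` residual tensor** `F_k = -(∂ₜ-Δ)R_k + ΔR̄_{k-1} + (𝒩_{k,1} + 𝒩_{k,2}) - ℛ div 𝒩_{k,2}`
(the level-`k` summands of `F₁ + F₂ + F₄ + v⊗v`). [cite: CoiculescuPalasek2025, Prop. 4.1 (`F₁`, `F₂`, `F₄`)] -/
def Fblock (k : ℕ) (t : ℝ) (x : UnitAddTorus (Fin 3)) (a b : Fin 3) : ℝ :=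
  I.heatResidual k t x a b + I.RbarLap k t x a b + I.selfInteraction k t x a b
    - antidivTensor (tensorDiv (I.N2 k t)) x a b

/-- **The level-`k` pressure** `π_k = ∂ₜQ̄_{k-1} - ΔQ̄_{k-1}`. [cite: CoiculescuPalasek2025, §4.1 with Def. 3.10 (`ℙ div`)] -/
def presBlock (k : ℕ) (t : ℝ) (x : UnitAddTorus (Fin 3)) : ℝ := I.QbarDt k t x - I.QbarLap k t x

/-- `blockDt = heatDt + (cascade part)`. [folklore] -/
theorem blockDt_eq (k : ℕ) (t : ℝ) (x : UnitAddTorus (Fin 3)) :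
    I.blockDt k t x = I.heatDt k t x + ∑ j, (-(2 * I.rate k j) * Real.exp (-(2 * I.rate k j * t))) • I.Wprev k j x := by
  simp only [blockDt, heatDt, Finset.sum_add_distrib]

/-- `N2` is symmetric. [cite: CoiculescuPalasek2025, Prop. 4.1] -/
theorem selfInteraction_symm (k : ℕ) (t : ℝ) (x : UnitAddTorus (Fin 3)) (a b : Fin 3) :
    I.selfInteraction k t x a b = I.selfInteraction k t x b a := by
  unfold selfInteraction; exact Finset.sum_congr rfl fun j _ => by ring

/-- `N2` is symmetric. [cite: CoiculescuPalasek2025, Prop. 4.1] -/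
theorem N2_symm (k : ℕ) (t : ℝ) (x : UnitAddTorus (Fin 3)) (a b : Fin 3) : I.N2 k t x a b = I.N2 k t x b a := by
  unfold N2; rw [I.selfInteraction_symm k t x a b, I.N1_symm k t x a b]

namespace Admissible

variable {I} (h : I.Admissible)
include h

/-! ### Smoothness -/

/-- `v^p_{j,k}` is smooth. [folklore] -/
theorem isSmooth_vpField (k : ℕ) (j : Fin 6) : IsSmooth (I.vpField k j) := (h.isSmooth_apsi k j).smul _

/-- The self-interaction is smooth in `x`. [folklore] -/
theorem isSmooth_selfInteraction (k : ℕ) (t : ℝ) : IsSmooth (I.selfInteraction k t) := by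
  refine isSmooth_of_entries fun a b => ?_
  show IsSmooth fun x => ∑ j, Real.exp (-(2 * I.rate k j * t)) * (I.vpField k j x a * I.vpField k j x b)
  exact Torus.isSmooth_finset_sum _ fun j _ => (((h.isSmooth_vpField k j).apply a).smul' ((h.isSmooth_vpField k j).apply b)).smul _

/-- `a_{j,k}` is smooth (all levels). [folklore] -/
theorem isSmooth_amp (k : ℕ) (j : Fin 6) : IsSmooth (I.amp k j) := (h.hasLiftDerivBounds_amp 0 k j).isSmooth

/-- `selfTensor` is smooth. [folklore] -/
theorem isSmooth_selfTensor (k : ℕ) (j : Fin 6) : IsSmooth (I.selfTensor k j) := by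
  refine isSmooth_of_entries fun a b => ?_
  have ha := h.isSmooth_amp k j
  have hfun : (fun x => I.selfTensor k j x a b) = fun x => (((nashDir j a : ℝ)) * (nashDir j b : ℝ)) • (I.amp k j x * I.amp k j x) := by
    funext x; simp only [selfTensor, smul_eq_mul, sq]; ring
  rw [hfun]
  exact (ha.smul' ha).smul _

/-- `𝒩_{k,1}(t)` is smooth in `x`. [folklore] -/
theorem isSmooth_N1 (k : ℕ) (t : ℝ) : IsSmooth (I.N1 k t) := by
  refine isSmooth_of_entries fun a b => ?_
  show IsSmooth fun x => ∑ j, (Real.exp (-(2 * I.rate k j * t)) * (I.rate k j ^ 2 * I.A k j * ((I.N k : ℝ) ^ 4)⁻¹)) * I.selfTensor k j x a b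
  exact Torus.isSmooth_finset_sum _ fun j _ => (isSmooth_entry (h.isSmooth_selfTensor k j) a b).smul _

/-- `𝒩_{k,2}(t)` is smooth in `x`. [folklore] -/
theorem isSmooth_N2 (k : ℕ) (t : ℝ) : IsSmooth (I.N2 k t) :=
  isSmooth_of_entries fun a b =>
    (isSmooth_entry (h.isSmooth_selfInteraction k t) a b).sub (isSmooth_entry (h.isSmooth_N1 k t) a b)

/-- `div 𝒩_{k,2}(t)` is smooth and has zero mean. [folklore] -/
theorem isSmooth_tensorDiv_N2 (k : ℕ) (t : ℝ) : IsSmooth (tensorDiv (I.N2 k t)) := isSmooth_tensorDiv (h.isSmooth_N2 k t)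

/-- `ℛ div 𝒩_{k,2}(t)` is smooth in `x`. [folklore] -/
theorem isSmooth_antidivTensor_N2 (k : ℕ) (t : ℝ) : IsSmooth (antidivTensor (tensorDiv (I.N2 k t))) :=
  isSmooth_antidivTensor (h.isSmooth_tensorDiv_N2 k t)

/-- `R̄`-Laplacian tensor is smooth in `x`. [folklore] -/
theorem isSmooth_RbarLap (k : ℕ) (t : ℝ) : IsSmooth (I.RbarLap k t) := by
  refine isSmooth_of_entries fun a b => ?_
  show IsSmooth fun x => ∑ j, (Real.exp (-(2 * I.rate k j * t)) * I.cprev k j) * tensorLap (I.Gprev k j) x a b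
  exact Torus.isSmooth_finset_sum _ fun j _ => (isSmooth_entry (isSmooth_tensorLap (h.isSmooth_Gprev k j)) a b).smul _

/-- `∂ₜR̄` tensor is smooth in `x`. [folklore] -/
theorem isSmooth_RbarDt (k : ℕ) (t : ℝ) : IsSmooth (I.RbarDt k t) := by
  refine isSmooth_of_entries fun a b => ?_
  show IsSmooth fun x => ∑ j, ((-(2 * I.rate k j) * Real.exp (-(2 * I.rate k j * t))) * I.cprev k j) * I.Gprev k j x a b
  exact Torus.isSmooth_finset_sum _ fun j _ => (isSmooth_entry (h.isSmooth_Gprev k j) a b).smul _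

/-- `heatResidual k t` is smooth in `x`. [folklore] -/
theorem isSmooth_heatResidual (k : ℕ) (t : ℝ) : IsSmooth (I.heatResidual k t) := by
  have : I.heatResidual k t = fun x => -∑ j, Real.exp (-(I.rate k j * t)) • I.heatDefectTensor k j x := rfl
  rw [this]
  exact (Torus.isSmooth_finset_sum _ fun j _ => (h.isSmooth_heatDefectTensor k j).smul _).neg

/-- `F_k(t)` is smooth in `x`. [folklore] -/
theorem isSmooth_Fblock (k : ℕ) (t : ℝ) : IsSmooth (I.Fblock k t) :=
  isSmooth_of_entries fun a b =>
    (((isSmooth_entry (h.isSmooth_heatResidual k t) a b).add (isSmooth_entry (h.isSmooth_RbarLap k t) a b)).add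
      (isSmooth_entry (h.isSmooth_selfInteraction k t) a b)).sub (isSmooth_entry (h.isSmooth_antidivTensor_N2 k t) a b)

/-- `∂ₜQ̄`, `ΔQ̄` and `π_k(t)` are smooth in `x`. [folklore] -/
theorem isSmooth_presBlock (k : ℕ) (t : ℝ) : IsSmooth (I.presBlock k t) := by
  have h1 : IsSmooth (I.QbarDt k t) := Torus.isSmooth_finset_sum _ fun j _ => (h.isSmooth_pressurePot_Gprev k j).smul _
  have h2 : IsSmooth (I.QbarLap k t) := Torus.isSmooth_finset_sum _ fun j _ => (h.isSmooth_pressurePot_Gprev k j).laplacian.smul _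
  exact h1.sub h2

/-! ### Symmetry of the block residual -/

omit h in
/-- `ΔR̄` is symmetric. [folklore] -/
theorem RbarLap_symm (k : ℕ) (t : ℝ) (x : UnitAddTorus (Fin 3)) (a b : Fin 3) : I.RbarLap k t x a b = I.RbarLap k t x b a := by
  unfold RbarLap tensorLap
  refine Finset.sum_congr rfl fun j _ => ?_
  congr 1
  congr 1
  funext z
  exact I.Gprev_symm k j z a b

/-- **`F_k(t)` is symmetric** (`F ∈ S^{3×3}`). [cite: CoiculescuPalasek2025, Prop. 4.1] -/
theorem Fblock_symm (k : ℕ) (t : ℝ) (x : UnitAddTorus (Fin 3)) (a b : Fin 3) : I.Fblock k t x a b = I.Fblock k t x b a := by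
  unfold Fblock
  rw [h.heatResidual_symm k t x a b, RbarLap_symm k t x a b, I.selfInteraction_symm k t x a b,
    antidivTensor_symm (h.isSmooth_tensorDiv_N2 k t) x a b]

/-! ### The divergence of the block residual and the block momentum identity -/

/-- **`div F_k(t) = -(∂ₜv_k - Δv_k) + div ΔR̄_{k-1} - div ∂ₜR̄_{k-1}`** (using `div ℛ div 𝒩_{k,2} = div 𝒩_{k,2}`,
`𝒩_{k,1} + 𝒩_{k,2} = ∑v^p⊗v^p`, and `div(∂ₜR̄_{k-1} + 𝒩_{k,1}) = 0`). [cite: CoiculescuPalasek2025, Prop. 4.1 (verification of (Frequirement))] -/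
theorem tensorDiv_Fblock (k : ℕ) (t : ℝ) (x : UnitAddTorus (Fin 3)) :
    tensorDiv (I.Fblock k t) x =
      -(I.heatDt k t x - Torus.laplacian (I.vHeat k t) x) + tensorDiv (I.RbarLap k t) x - tensorDiv (I.RbarDt k t) x := by
  have hHR := h.isSmooth_heatResidual k t
  have hRL := h.isSmooth_RbarLap k t
  have hSI := h.isSmooth_selfInteraction k t
  have hN1 := h.isSmooth_N1 k t
  have hN2 := h.isSmooth_N2 k t
  have hA := h.isSmooth_antidivTensor_N2 k t
  have hRD := h.isSmooth_RbarDt k t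
  -- split the four terms
  have hsplit : I.Fblock k t = fun y a b => (fun y a b => (fun y a b => I.heatResidual k t y a b + I.RbarLap k t y a b) y a b
      + I.selfInteraction k t y a b) y a b - antidivTensor (tensorDiv (I.N2 k t)) y a b := rfl
  have h12 : IsSmooth (fun y a b => I.heatResidual k t y a b + I.RbarLap k t y a b) :=
    isSmooth_of_entries fun a b => (isSmooth_entry hHR a b).add (isSmooth_entry hRL a b)
  have h123 : IsSmooth (fun y a b => (fun y a b => I.heatResidual k t y a b + I.RbarLap k t y a b) y a b + I.selfInteraction k t y a b) :=
    isSmooth_of_entries fun a b => (isSmooth_entry h12 a b).add (isSmooth_entry hSI a b)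
  rw [hsplit, tensorDiv_sub' h123 hA, tensorDiv_add' h12 hSI, tensorDiv_add' hHR hRL,
    tensorDiv_antidivTensor (h.isSmooth_tensorDiv_N2 k t) (hasZeroMean_tensorDiv hN2) x]
  -- `div N2 = div selfInteraction - div N1`, `div N1 = -div RbarDt`
  have hN2' : tensorDiv (I.N2 k t) x = tensorDiv (I.selfInteraction k t) x - tensorDiv (I.N1 k t) x := by
    rw [show I.N2 k t = fun y a b => I.selfInteraction k t y a b - I.N1 k t y a b from rfl, tensorDiv_sub' hSI hN1]
  have hcancel := h.tensorDiv_RbarDt_add_N1 k t x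
  rw [tensorDiv_add' hRD hN1] at hcancel
  rw [hN2', h.tensorDiv_heatResidual k t x]
  have hN1' : tensorDiv (I.N1 k t) x = -tensorDiv (I.RbarDt k t) x := eq_neg_of_add_eq_zero_right hcancel
  rw [hN1']
  simp only [heatDt]
  abel

/-- `Δ(v_k + v̄_{k-1}) = Δv_k + div ΔR̄ - ∇ΔQ̄`. [folklore] -/
theorem laplacian_block (k : ℕ) (t : ℝ) (x : UnitAddTorus (Fin 3)) :
    Torus.laplacian (I.block k t) x =
      Torus.laplacian (I.vHeat k t) x + (tensorDiv (I.RbarLap k t) x - Torus.gradient (I.QbarLap k t) x) := by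
  rw [show I.block k t = fun y => I.vHeat k t y + I.cascadePrev k t y from rfl,
    laplacian_add_apply (h.isSmooth_vHeat k t) (h.isSmooth_cascadePrev k t), h.laplacian_cascadePrev]

/-- **The block momentum identity**: `∂ₜ(v_k + v̄_{k-1})(t) = Δ(v_k + v̄_{k-1})(t) - ∇π_k(t) - div F_k(t)` pointwise.
[cite: CoiculescuPalasek2025, Prop. 4.1 ((Frequirement) level by level)] -/
theorem blockDt_eq_laplacian_sub (k : ℕ) (t : ℝ) (x : UnitAddTorus (Fin 3)) :
    I.blockDt k t x = Torus.laplacian (I.block k t) x - Torus.gradient (I.presBlock k t) x - tensorDiv (I.Fblock k t) x := by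
  have hQD : IsSmooth (I.QbarDt k t) := Torus.isSmooth_finset_sum _ fun j _ => (h.isSmooth_pressurePot_Gprev k j).smul _
  have hQL : IsSmooth (I.QbarLap k t) := Torus.isSmooth_finset_sum _ fun j _ => (h.isSmooth_pressurePot_Gprev k j).laplacian.smul _
  rw [I.blockDt_eq, h.cascadeDt_eq, h.laplacian_block, h.tensorDiv_Fblock,
    show I.presBlock k t = fun y => I.QbarDt k t y - I.QbarLap k t y from rfl, gradient_sub' hQD hQL]
  abel

end Admissible

end IterData

end CP25

end Literature.Analysis.FluidPDE
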